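import Summits.BirchSwinnertonDyer.BirchSwinnertonDyer.Theorems.ErratumRoadFiveKernelUpperFromPrint
import Summits.BirchSwinnertonDyer.BirchSwinnertonDyer.Theorems.ErratumRoadFiveClassicalValueFromPrint
import HarnessLib

/-!
# Route `ErratumRoadFive` (K2 at `p ≥ 5`): the kernel-from-print upper theorem with the two no-road
# residuals VALUE-FREE — a Theses-free `<KERNEL_THM>` for the planner's floated D5 re-typing

Cell `bsd-stepL` (run/shared/lean/pub/bsd-stepL/), seat `bsd-stepL-bdp` (prover g12, 2026-08-26),
`--supports stmt-BirchSwinnertonDyer-19624`. Imports ONLY modules that do not import the route file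
(p439441 `ErratumRoadFiveKernelUpperFromPrint`, p442735 `ErratumRoadFiveClassicalValueFromPrint`), so it
is citable from the route's `closes` (D1 ∕ D4 pattern).

Planner g25 floated D5 (STATUS 12:17:28Z): re-type K2 rev 12's two NO-ROAD residual cruxes 19282
`OpenInputNotRam` (¬(ram) pairs, cw 112 239) and 19624 `RamNoErratumDataAtFive` (REST‴, cw 703 204)
VALUE-FREE, as «(2.4)∃♭ `P2.IMCDivSomeFrameOnTree W p` on their pairs» + the JIMJ18 fact by name. This
file supplies the kernel theorem such a `closes` needs:

* `openInputIMCBody_of_print_of_core_of_imcDivSomeFrame` — p439441's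
  `KernelFromPrint.openInputIMCBody_of_print_of_core_of_rest3_of_notRam` with its two
  `P2OpenInputOnTreeAt`-valued binders `hrest` ∕ `hOff` REPLACED by the value-free shapes
  `hrestD : ∀ W p, Ram W p → ¬(odd non-split ramified witness ∧ (iv)) → P2.IMCDivSomeFrameOnTree W p` and
  `hOffD : ∀ W p, ¬ Ram W p → P2.IMCDivSomeFrameOnTree W p`, plus the REVIEWED fact
  `Castella2018Exceptional.thm210_thm211_bdpDisplay_pNew` (`hB`); conclusion unchanged
  (`∀ W p, P2OpenInputOnTreeAt W p` = the body of the aside crux 19061). Proof: p442735's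
  `ramNoErratumData_of_imcDivSomeFrame_of_pNew` ∕ `openInputNotRam_of_imcDivSomeFrame_of_pNew` (whose
  published inputs `hnf`, `hGZK`, `hKo`, `hPT`, `hEP` are conjuncts of `hF` = item 19283's body) feed
  p439441. Argument order: `hVN hB h3 hF hWu h331 hrestD hOffD`.
* `openInputIMCBody_of_print_of_core_of_imcDivSomeFrame_intCast` — twin with the `(p : ℤ) ∣ …` spelling
  of the valuation clause.

HONEST FRAMING: theorems only; CONDITIONAL on the two cited facts, on H3♭ at erratum data (`h3`, item
19270, PREPRINT-derived) and on (2.4)∃♭ at classical data on the two residual loci (OPEN, no road in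
print — PROOF-BDP §30 names the one sourceless brick); nothing is booked; no label, tier or census word
moves (T7). Whether D5 is run is the director's ∕ planner's call; this file only makes it turnkey.
-/

set_option autoImplicit false

noncomputable section

open scoped Classical Topology
open Filter WeierstrassCurve NumberField IsDedekindDomain Field PowerSeries
open Literature.NumberTheory.EllipticCurves Literature.NumberTheory.EllipticCurves.GreenbergSelmer
open Literature.NumberTheory.EllipticCurves.ModularForms
open Literature.NumberTheory.EllipticCurves.Rank1Residual
open Literature.NumberTheory.EllipticCurves.Rank1Residual.Typed
open Literature.NumberTheory.EllipticCurves.Wuthrich2014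
open Literature.NumberTheory.EllipticCurves.Castella2018
open Literature.NumberTheory.EllipticCurves.Castella2018Exceptional
open Literature.NumberTheory.EllipticCurves.JetchevSkinnerWan2017
open Literature.NumberTheory.GaloisRepresentations
open Literature.NumberTheory.GaloisCohomology
open Summit.BirchSwinnertonDyer.Rank1Residual Summit.BirchSwinnertonDyer.Rank1Residual.X11b
open Summit.BirchSwinnertonDyer.Rank1Residual.X11b.Halves

namespace Summit.BirchSwinnertonDyer.BirchSwinnertonDyer.Theorems.KernelFromPrint

/-- **The kernel-from-print upper theorem with VALUE-FREE residuals** (D5 `<KERNEL_THM>`): route p2's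
composite open input `P2OpenInputOnTreeAt W p` at EVERY pair from (VN_p) (JIMJ18 fact in Castella's
currency, `hVN`), the JIMJ18 fact in BDP's currency (`hB`), H3♭ at every erratum datum (`h3`), item
19283's sixteen published ∕ cited facts (`hF`), Wuthrich (`hWu`), JSW 3.3.1-mult (`h331`), and the two
VALUE-FREE residuals: (2.4)∃♭ on the (ram) pairs with no erratum datum (`hrestD`) and on the ¬(ram)
pairs (`hOffD`). = p439441 ∘ p442735. CONDITIONAL; nothing booked.
[cite: Castella2018Exceptional, Thms. 2.10–2.11 (arXiv:1507.04260 pp. 13–14)]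
[cite: Castella2018Erratum, (2.4) and Thm. 1.1 (pp. 1, 4)] [cite: Castella2018, Thms. 2.3, 3.1, 3.2, §5]
[cite: JetchevSkinnerWan2017, Thm. 3.3.1 (pp. 16–17)] [cite: Wuthrich2014, Prop. 21 (p. 400)]
[cite: Miller2011LMS, Def. 1.1] -/
theorem openInputIMCBody_of_print_of_core_of_imcDivSomeFrame
    (hVN : castella2018Exceptional_bdpValueContinuity_trivialChar)
    (hB : thm210_thm211_bdpDisplay_pNew)
    (h3 : ∀ (W : WeierstrassCurve ℚ) [W.IsElliptic] [W.IsGloballyMinimal] (p : ℕ) [Fact p.Prime],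
      P2.IMCDivIntCoreFrameAtErratumData W p)
    (hF : GrossZagier1986_thm_I_7_3 ∧ rank_eq_analyticRank_of_analyticRank_le_one ∧
      Skinner2016.thmC_padicValRat_bsd_rank_zero ∧ exists_isNewformOf ∧
      CaiShuTian2014.thm11_trivialChar ∧ friedbergHoffstein_exists_twist_ne_zero_ramifiedAt ∧
      mazur_not_dvd_maninConstant_of_odd ∧
      (∀ (N : ℕ) [NeZero N] (W : WeierstrassCurve ℚ) (K : Type) [Field K] [NumberField K],
        gross_zagier N W K) ∧
      (∀ (N : ℕ) [NeZero N] (W : WeierstrassCurve ℚ) (K : Type) [Field K] [NumberField K],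
        kolyvagin N W K) ∧
      (∀ (N : ℕ) [NeZero N] (W : WeierstrassCurve ℚ) (K : Type) [Field K] [NumberField K],
        Kolyvagin1990_padicValNat_card_sha_le N W K) ∧
      HoffsteinLuo1997_exists_twist_L_one_ne_zero ∧
      (∀ (K : Type) [Field K] [NumberField K], poitouTate_sum_localTatePairing_eq_zero K) ∧
      (∀ (K : Type) [Field K] [NumberField K], poitouTate_selmerStructure_duality K) ∧
      (∀ (K : Type) [Field K] [NumberField K], poitouTate_sha_tateDual K) ∧
      (∀ (K : Type) [Field K] [NumberField K] (v : HeightOneSpectrum (𝓞 K)),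
        localEulerPoincareCharacteristic (v.adicCompletion K)) ∧
      fieldCdLE_two_of_numberField)
    (hWu : sha_dvd_analyticSha) (h331 : thm331_anticyclotomicControl_mult)
    (hrestD : ∀ (W : WeierstrassCurve ℚ) [W.IsElliptic] [W.IsGloballyMinimal] (p : ℕ) [Fact p.Prime],
      Ram W p →
      ¬ ((∃ (q : ℕ) (_ : Fact q.Prime), q ≠ 2 ∧ q ≠ p ∧ Mult W q ∧
            ¬ W.HasSplitMultiplicativeReductionAtPrime q ∧
            ¬ p ∣ padicValInt q W.minimalDiscriminantInt) ∧
          (∀ P : (W.baseChange ℚ_[p]).toAffine.Point, p • P = 0 → P = 0)) →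
      P2.IMCDivSomeFrameOnTree W p)
    (hOffD : ∀ (W : WeierstrassCurve ℚ) [W.IsElliptic] [W.IsGloballyMinimal] (p : ℕ) [Fact p.Prime],
      ¬ Ram W p → P2.IMCDivSomeFrameOnTree W p) :
    ∀ (W : WeierstrassCurve ℚ) [W.IsElliptic] [W.IsGloballyMinimal] (p : ℕ) [Fact p.Prime],
      P2OpenInputOnTreeAt W p := by
  have hF₀ := hF
  obtain ⟨-, hGZK, -, hnf, -, -, -, -, hKo, -, -, hPT, -, -, hEP, -⟩ := hF₀
  exact openInputIMCBody_of_print_of_core_of_rest3_of_notRam hVN h3 hF hWu h331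
    (ramNoErratumData_of_imcDivSomeFrame_of_pNew hnf hGZK hKo hPT hEP hB hrestD)
    (openInputNotRam_of_imcDivSomeFrame_of_pNew hnf hGZK hKo hPT hEP hB hOffD)

/-- **Twin with the `(p : ℤ) ∣ padicValInt …` spelling** of the valuation clause in the REST‴ locus
(for a D5 crux text written in the ℤ-divisibility convention). CONDITIONAL; nothing booked.
[cite: Castella2018Exceptional, Thms. 2.10–2.11 (arXiv:1507.04260 pp. 13–14)]
[cite: Castella2018Erratum, (2.4) and Thm. 1.1 (pp. 1, 4)] [cite: Castella2018, Thms. 2.3, 3.1, 3.2, §5] -/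
theorem openInputIMCBody_of_print_of_core_of_imcDivSomeFrame_intCast
    (hVN : castella2018Exceptional_bdpValueContinuity_trivialChar)
    (hB : thm210_thm211_bdpDisplay_pNew)
    (h3 : ∀ (W : WeierstrassCurve ℚ) [W.IsElliptic] [W.IsGloballyMinimal] (p : ℕ) [Fact p.Prime],
      P2.IMCDivIntCoreFrameAtErratumData W p)
    (hF : GrossZagier1986_thm_I_7_3 ∧ rank_eq_analyticRank_of_analyticRank_le_one ∧
      Skinner2016.thmC_padicValRat_bsd_rank_zero ∧ exists_isNewformOf ∧
      CaiShuTian2014.thm11_trivialChar ∧ friedbergHoffstein_exists_twist_ne_zero_ramifiedAt ∧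
      mazur_not_dvd_maninConstant_of_odd ∧
      (∀ (N : ℕ) [NeZero N] (W : WeierstrassCurve ℚ) (K : Type) [Field K] [NumberField K],
        gross_zagier N W K) ∧
      (∀ (N : ℕ) [NeZero N] (W : WeierstrassCurve ℚ) (K : Type) [Field K] [NumberField K],
        kolyvagin N W K) ∧
      (∀ (N : ℕ) [NeZero N] (W : WeierstrassCurve ℚ) (K : Type) [Field K] [NumberField K],
        Kolyvagin1990_padicValNat_card_sha_le N W K) ∧
      HoffsteinLuo1997_exists_twist_L_one_ne_zero ∧
      (∀ (K : Type) [Field K] [NumberField K], poitouTate_sum_localTatePairing_eq_zero K) ∧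
      (∀ (K : Type) [Field K] [NumberField K], poitouTate_selmerStructure_duality K) ∧
      (∀ (K : Type) [Field K] [NumberField K], poitouTate_sha_tateDual K) ∧
      (∀ (K : Type) [Field K] [NumberField K] (v : HeightOneSpectrum (𝓞 K)),
        localEulerPoincareCharacteristic (v.adicCompletion K)) ∧
      fieldCdLE_two_of_numberField)
    (hWu : sha_dvd_analyticSha) (h331 : thm331_anticyclotomicControl_mult)
    (hrestD : ∀ (W : WeierstrassCurve ℚ) [W.IsElliptic] [W.IsGloballyMinimal] (p : ℕ) [Fact p.Prime],
      Ram W p →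
      ¬ ((∃ (q : ℕ) (_ : Fact q.Prime), q ≠ 2 ∧ q ≠ p ∧ Mult W q ∧
            ¬ W.HasSplitMultiplicativeReductionAtPrime q ∧
            ¬ (p : ℤ) ∣ (padicValInt q W.minimalDiscriminantInt : ℤ)) ∧
          (∀ P : (W.baseChange ℚ_[p]).toAffine.Point, p • P = 0 → P = 0)) →
      P2.IMCDivSomeFrameOnTree W p)
    (hOffD : ∀ (W : WeierstrassCurve ℚ) [W.IsElliptic] [W.IsGloballyMinimal] (p : ℕ) [Fact p.Prime],
      ¬ Ram W p → P2.IMCDivSomeFrameOnTree W p) :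
    ∀ (W : WeierstrassCurve ℚ) [W.IsElliptic] [W.IsGloballyMinimal] (p : ℕ) [Fact p.Prime],
      P2OpenInputOnTreeAt W p := by
  refine openInputIMCBody_of_print_of_core_of_imcDivSomeFrame hVN hB h3 hF hWu h331
    (fun W _ _ p _ hram hw ↦ hrestD W p hram fun hw' ↦ hw ?_) hOffD
  obtain ⟨⟨q, hqF, hq2, hqp, hmq, hnsq, hvq⟩, htors⟩ := hw'
  refine ⟨⟨q, hqF, hq2, hqp, hmq, hnsq, fun hd ↦ hvq ?_⟩, htors⟩
  exact_mod_cast hd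

end Summit.BirchSwinnertonDyer.BirchSwinnertonDyer.Theorems.KernelFromPrint

end
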